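import Summits.Ventures.PercRepro.Night2StarPairs

/-!
# PercRepro — night-2: the «two long circuits» case of `(★)` (blind cell pub-perc-repro, night-2 gen 1)

Over `Night2StarPairs`: the arithmetic of a single and of a pair (`single_term_ge`, `single_arith`, `long_arith`, `pair_term_ge` —
the pair `B ∪ {i, u}` pays `≥ [q/(1 + m_u) − Φ]/(c_i c_u)`), the budget of one point against two long points (`small_budget`:
single + two pairs `≥ (1 − 5/(3c_i))/(q + 1) ≥ (4/9)/(q + 1)`), and
* **`rec_ge_of_two_long`** — TWO LONG CIRCUITS, CORANK `≥ 4` (Proposition 4.2 of `proofs/NIGHT-2-star.md`, «Proposition 8» on the bus):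
  a basis `B` with two points `u, v` of `G ∖ B` whose singles have `m ≤ q − 8` coloops (fundamental circuits of `≥ 9` points) and two
  further points `i, j` of `G ∖ B` receives `rec(B) ≥ 2/(q + 1)`: `2/3 + 2/3 + 4/9 + 4/9 ≥ 2`.
-/

namespace PercRepro.Star

open Finset ThmH SixFour GenQ

variable {α : Type*} [DecidableEq α] {M : Matroid α} [M.Finite]

/-! ## The arithmetic of a single and of a pair -/

/-- A single with `m` coloops pays at least `[q/(1 + m) − Φ]/(q + 1 − m)`. -/
theorem single_term_ge (hs : Simple M) {G S : Finset α} {q : ℕ} (hG : G ⊆ gr M) (hS : S ⊆ G)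
    (hr : M.eRk (S : Set α) = (q : ℕ∞)) (hq : 1 ≤ q) (hcard : S.card = q + 1) :
    ((q : ℚ) / (1 + (mTr M S : ℚ)) - ((q : ℚ) + 2) / ((q : ℚ) + 1)) / ((q : ℚ) + 1 - (mTr M S : ℚ)) ≤
      surplus M G q S / (bIn M G q S : ℚ) := by
  have hb := bIn_add_mTr_le_of_card hG hS hr hcard
  have hbpos := bIn_pos hG hS hr
  have hm := mTr_add_two_le_of_spanning_nonbasis hs (hS.trans hG) hr hq (by omega)
  have hmq : (mTr M S : ℚ) + 2 ≤ q := by exact_mod_cast hm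
  have hbq : (bIn M G q S : ℚ) + (mTr M S : ℚ) ≤ (q : ℚ) + 1 := by exact_mod_cast hb
  have hb1 : (1 : ℚ) ≤ (bIn M G q S : ℚ) := by exact_mod_cast hbpos
  have hm0 : (0 : ℚ) ≤ (mTr M S : ℚ) := by positivity
  have hsur := surplus_ge_dem (M := M) (G := G) (S := S) q
  unfold wInf at hsur
  rw [mul_one_div] at hsur
  have hnum : (0 : ℚ) ≤ (q : ℚ) / (1 + (mTr M S : ℚ)) - ((q : ℚ) + 2) / ((q : ℚ) + 1) := by
    rw [sub_nonneg, div_le_div_iff₀ (by positivity) (by positivity)]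
    nlinarith
  calc ((q : ℚ) / (1 + (mTr M S : ℚ)) - ((q : ℚ) + 2) / ((q : ℚ) + 1)) / ((q : ℚ) + 1 - (mTr M S : ℚ))
      ≤ ((q : ℚ) / (1 + (mTr M S : ℚ)) - ((q : ℚ) + 2) / ((q : ℚ) + 1)) / (bIn M G q S : ℚ) := by
        apply div_le_div_of_nonneg_left hnum (by linarith) (by linarith)
    _ ≤ surplus M G q S / (bIn M G q S : ℚ) := by
        apply div_le_div_of_nonneg_right hsur (by linarith)

/-- `[q/(1 + m) − Φ]/(q + 1 − m) ≥ (q + 1 − m − 3)/((q + 1 − m)(q + 1))` for `m + 2 ≤ q` (the size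
`c = q + 1 − m` of the circuit: a single pays `≥ (c − 3)/(c (q + 1))`). -/
theorem single_arith {q m : ℚ} (hm0 : 0 ≤ m) (hmq : m + 2 ≤ q) :
    ((q + 1 - m) - 3) / ((q + 1 - m) * (q + 1)) ≤ (q / (1 + m) - (q + 2) / (q + 1)) / (q + 1 - m) := by
  have h1 : (0 : ℚ) < 1 + m := by linarith
  have h2 : (0 : ℚ) < q + 1 := by linarith
  have h3 : (0 : ℚ) < q + 1 - m := by linarith
  rw [div_sub_div _ _ h1.ne' h2.ne', div_div, div_le_div_iff₀ (by positivity) (by positivity)]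
  have hD : (0 : ℚ) ≤ (q + 1 - m) * (q + 1) := by positivity
  have hcore : (q + 1 - m - 3) * (1 + m) ≤ q * (q + 1) - (1 + m) * (q + 2) := by
    nlinarith [mul_nonneg (sub_nonneg.2 hmq) (sub_nonneg.2 hmq), mul_nonneg hm0 (sub_nonneg.2 hmq)]
  nlinarith [mul_le_mul_of_nonneg_right hcore hD]

/-- `[q/(1 + m) − Φ]/(q + 1 − m) ≥ 2/(3(q + 1))` for `m + 8 ≤ q` (a circuit of `≥ 9` points pays `2/3`). -/
theorem long_arith {q m : ℚ} (hm0 : 0 ≤ m) (hmq : m + 8 ≤ q) :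
    2 / (3 * (q + 1)) ≤ (q / (1 + m) - (q + 2) / (q + 1)) / (q + 1 - m) := by
  have h1 : (0 : ℚ) < 1 + m := by linarith
  have h2 : (0 : ℚ) < q + 1 := by linarith
  have h3 : (0 : ℚ) < q + 1 - m := by linarith
  rw [div_sub_div _ _ h1.ne' h2.ne', div_div, div_le_div_iff₀ (by positivity) (by positivity)]
  nlinarith [mul_nonneg hm0 (sub_nonneg.2 hmq), mul_nonneg hm0 hm0, mul_nonneg (sub_nonneg.2 hmq) (sub_nonneg.2 hmq),
    mul_nonneg hm0 h3.le, mul_nonneg (sub_nonneg.2 hmq) h3.le]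

/-- The pair `B ∪ {i, u}` pays at least `[q/(1 + m_u) − Φ]/(c_i · c_u)`, `c = q + 1 − m` the circuit sizes. -/
theorem pair_term_ge (hs : Simple M) {G B : Finset α} {q : ℕ} (hG : G ⊆ gr M)
    (hrG : M.eRk (G : Set α) = (q : ℕ∞)) (hB : B ∈ Bq M G q) (hq : 1 ≤ q) {i u : α} (hi : i ∈ G \ B)
    (hu : u ∈ G \ B) (hiu : i ≠ u) :
    ((q : ℚ) / (1 + (mTr M (insert u B) : ℚ)) - ((q : ℚ) + 2) / ((q : ℚ) + 1)) /
        (((q : ℚ) + 1 - (mTr M (insert i B) : ℚ)) * ((q : ℚ) + 1 - (mTr M (insert u B) : ℚ))) ≤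
      surplus M G q (insert i (insert u B)) / (bIn M G q (insert i (insert u B)) : ℚ) := by
  obtain ⟨hSi, hci⟩ := insert_mem_SNq hrG hB hi
  obtain ⟨hSu, hcu⟩ := insert_mem_SNq hrG hB hu
  obtain ⟨hS2, hc2⟩ := insert_insert_mem_SNq hrG hB hi hu hiu
  obtain ⟨hS2G, hr2, -⟩ := mem_SNq.1 hS2
  have hmu := mTr_add_two_le_of_spanning_nonbasis hs ((mem_SNq.1 hSu).1.trans hG) (mem_SNq.1 hSu).2.1 hq
    (by omega)
  have hmi := mTr_add_two_le_of_spanning_nonbasis hs ((mem_SNq.1 hSi).1.trans hG) (mem_SNq.1 hSi).2.1 hq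
    (by omega)
  have hm2 := mTr_insert_insert_le hG hrG hB hi hiu
  have hbb := bIn_insert_insert_le hG hrG hB hi hu hiu
  have hbpos := bIn_pos hG hS2G hr2
  -- the circuit sizes
  have hcx : ((insert i B) \ coloopsOf M (insert i B)).card = q + 1 - mTr M (insert i B) := by
    rw [Finset.card_sdiff_of_subset (coloopsOf_subset _), hci]
    rfl
  have hcy : ((insert u B) \ coloopsOf M (insert u B)).card = q + 1 - mTr M (insert u B) := by
    rw [Finset.card_sdiff_of_subset (coloopsOf_subset _), hcu]
    rfl
  rw [hcx, hcy] at hbb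
  have hmuq : (mTr M (insert u B) : ℚ) + 2 ≤ q := by exact_mod_cast hmu
  have hmiq : (mTr M (insert i B) : ℚ) + 2 ≤ q := by exact_mod_cast hmi
  have hm2q : (mTr M (insert i (insert u B)) : ℚ) ≤ (mTr M (insert u B) : ℚ) := by exact_mod_cast hm2
  have hbbq : (bIn M G q (insert i (insert u B)) : ℚ) ≤
      ((q : ℚ) + 1 - (mTr M (insert i B) : ℚ)) * ((q : ℚ) + 1 - (mTr M (insert u B) : ℚ)) := by
    have : (bIn M G q (insert i (insert u B)) : ℚ) ≤ ((q + 1 - mTr M (insert i B) : ℕ) : ℚ) *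
        ((q + 1 - mTr M (insert u B) : ℕ) : ℚ) := by exact_mod_cast hbb
    rw [Nat.cast_sub (by omega), Nat.cast_sub (by omega)] at this
    push_cast at this
    exact this
  have hb1 : (1 : ℚ) ≤ (bIn M G q (insert i (insert u B)) : ℚ) := by exact_mod_cast hbpos
  have hm20 : (0 : ℚ) ≤ (mTr M (insert i (insert u B)) : ℚ) := by positivity
  have hsur := surplus_ge_dem (M := M) (G := G) (S := insert i (insert u B)) q
  unfold wInf at hsur
  rw [mul_one_div] at hsur
  have hq1 : (0 : ℚ) < (q : ℚ) + 1 := by positivity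
  have hnum : (0 : ℚ) ≤ (q : ℚ) / (1 + (mTr M (insert u B) : ℚ)) - ((q : ℚ) + 2) / ((q : ℚ) + 1) := by
    rw [sub_nonneg, div_le_div_iff₀ hq1 (by positivity)]
    nlinarith
  have hmono : (q : ℚ) / (1 + (mTr M (insert u B) : ℚ)) ≤ (q : ℚ) / (1 + (mTr M (insert i (insert u B)) : ℚ)) := by
    apply div_le_div_of_nonneg_left (by positivity) (by positivity) (by linarith)
  calc ((q : ℚ) / (1 + (mTr M (insert u B) : ℚ)) - ((q : ℚ) + 2) / ((q : ℚ) + 1)) /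
        (((q : ℚ) + 1 - (mTr M (insert i B) : ℚ)) * ((q : ℚ) + 1 - (mTr M (insert u B) : ℚ)))
      ≤ ((q : ℚ) / (1 + (mTr M (insert u B) : ℚ)) - ((q : ℚ) + 2) / ((q : ℚ) + 1)) /
          (bIn M G q (insert i (insert u B)) : ℚ) := by
        apply div_le_div_of_nonneg_left hnum (by linarith) hbbq
    _ ≤ surplus M G q (insert i (insert u B)) / (bIn M G q (insert i (insert u B)) : ℚ) := by
        apply div_le_div_of_nonneg_right _ (by linarith)
        linarith

/-! ## Two long circuits and corank `≥ 4` -/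

/-- The budget of one small point `i` against two long points `u, v`: its single and its two pairs with `u, v` pay
together `≥ (4/9)/(q + 1)`. -/
theorem small_budget (hs : Simple M) {G B : Finset α} {q : ℕ} (hG : G ⊆ gr M)
    (hrG : M.eRk (G : Set α) = (q : ℕ∞)) (hB : B ∈ Bq M G q) (hq : 1 ≤ q) {i u v : α} (hi : i ∈ G \ B)
    (hu : u ∈ G \ B) (hv : v ∈ G \ B) (hiu : i ≠ u) (hiv : i ≠ v) (hmu : mTr M (insert u B) + 8 ≤ q)
    (hmv : mTr M (insert v B) + 8 ≤ q) :
    (4 / 9) / ((q : ℚ) + 1) ≤ surplus M G q (insert i B) / (bIn M G q (insert i B) : ℚ) +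
      (surplus M G q (insert i (insert u B)) / (bIn M G q (insert i (insert u B)) : ℚ) +
        surplus M G q (insert i (insert v B)) / (bIn M G q (insert i (insert v B)) : ℚ)) := by
  obtain ⟨hSi, hci⟩ := insert_mem_SNq hrG hB hi
  have hmi := mTr_add_two_le_of_spanning_nonbasis hs ((mem_SNq.1 hSi).1.trans hG) (mem_SNq.1 hSi).2.1 hq
    (by omega)
  have h1 := single_term_ge hs hG (mem_SNq.1 hSi).1 (mem_SNq.1 hSi).2.1 hq hci
  have h2 := pair_term_ge hs hG hrG hB hq hi hu hiu
  have h3 := pair_term_ge hs hG hrG hB hq hi hv hiv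
  set mi : ℚ := (mTr M (insert i B) : ℚ) with hmi_def
  set mu : ℚ := (mTr M (insert u B) : ℚ) with hmu_def
  set mv : ℚ := (mTr M (insert v B) : ℚ) with hmv_def
  have hmi0 : (0 : ℚ) ≤ mi := by rw [hmi_def]; positivity
  have hmu0 : (0 : ℚ) ≤ mu := by rw [hmu_def]; positivity
  have hmv0 : (0 : ℚ) ≤ mv := by rw [hmv_def]; positivity
  have hmiq : mi + 2 ≤ q := by rw [hmi_def]; exact_mod_cast hmi
  have hmuq : mu + 8 ≤ q := by rw [hmu_def]; exact_mod_cast hmu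
  have hmvq : mv + 8 ≤ q := by rw [hmv_def]; exact_mod_cast hmv
  have ha := single_arith hmi0 hmiq
  have hbu := long_arith hmu0 hmuq
  have hbv := long_arith hmv0 hmvq
  have hq1 : (0 : ℚ) < (q : ℚ) + 1 := by positivity
  have hc : (0 : ℚ) < (q : ℚ) + 1 - mi := by linarith
  -- the pair terms in the form `(long single)/c_i`
  have hpu : (2 / (3 * ((q : ℚ) + 1))) / ((q : ℚ) + 1 - mi) ≤
      ((q : ℚ) / (1 + mu) - ((q : ℚ) + 2) / ((q : ℚ) + 1)) / (((q : ℚ) + 1 - mi) * ((q : ℚ) + 1 - mu)) := by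
    calc (2 / (3 * ((q : ℚ) + 1))) / ((q : ℚ) + 1 - mi)
        ≤ ((q : ℚ) / (1 + mu) - ((q : ℚ) + 2) / ((q : ℚ) + 1)) / ((q : ℚ) + 1 - mu) / ((q : ℚ) + 1 - mi) :=
          div_le_div_of_nonneg_right hbu hc.le
      _ = ((q : ℚ) / (1 + mu) - ((q : ℚ) + 2) / ((q : ℚ) + 1)) / (((q : ℚ) + 1 - mi) * ((q : ℚ) + 1 - mu)) := by
          rw [div_div]; ring
  have hpv : (2 / (3 * ((q : ℚ) + 1))) / ((q : ℚ) + 1 - mi) ≤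
      ((q : ℚ) / (1 + mv) - ((q : ℚ) + 2) / ((q : ℚ) + 1)) / (((q : ℚ) + 1 - mi) * ((q : ℚ) + 1 - mv)) := by
    calc (2 / (3 * ((q : ℚ) + 1))) / ((q : ℚ) + 1 - mi)
        ≤ ((q : ℚ) / (1 + mv) - ((q : ℚ) + 2) / ((q : ℚ) + 1)) / ((q : ℚ) + 1 - mv) / ((q : ℚ) + 1 - mi) :=
          div_le_div_of_nonneg_right hbv hc.le
      _ = ((q : ℚ) / (1 + mv) - ((q : ℚ) + 2) / ((q : ℚ) + 1)) / (((q : ℚ) + 1 - mi) * ((q : ℚ) + 1 - mv)) := by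
          rw [div_div]; ring
  set c : ℚ := (q : ℚ) + 1 - mi with hc_def
  have hc3 : (3 : ℚ) ≤ c := by rw [hc_def]; linarith
  have e1 : 2 * ((2 / (3 * ((q : ℚ) + 1))) / c) = (4 / 3) / (c * ((q : ℚ) + 1)) := by
    field_simp
    ring
  have hkey : (4 / 9) / ((q : ℚ) + 1) ≤ (c - 3) / (c * ((q : ℚ) + 1)) + (4 / 3) / (c * ((q : ℚ) + 1)) := by
    rw [← add_div, div_le_div_iff₀ hq1 (by positivity)]
    nlinarith [mul_nonneg (sub_nonneg.2 hc3) hq1.le]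
  linarith

/-- `insert a B = insert b B` with `a, b ∉ B` forces `a = b`. -/
theorem eq_of_insert_eq {B : Finset α} {a b : α} (ha : a ∉ B) (hab : insert a B = insert b B) : a = b := by
  have : a ∈ insert b B := by rw [← hab]; exact Finset.mem_insert_self a B
  rcases Finset.mem_insert.1 this with h | h
  · exact h
  · exact absurd h ha

/-- **Two long circuits, corank `≥ 4` (Proposition 8)**: a basis `B` of `G` with points `u, v` of `G ∖ B` whose singles
have at most `q − 8` coloops, and two further points `i, j` of `G ∖ B`, receives `rec(B) ≥ 2/(q + 1)`. -/
theorem rec_ge_of_two_long (hs : Simple M) {G B : Finset α} {q : ℕ} (hG : G ⊆ gr M)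
    (hrG : M.eRk (G : Set α) = (q : ℕ∞)) (hB : B ∈ Bq M G q) (hq : 1 ≤ q) {u v i j : α} (hu : u ∈ G \ B)
    (hv : v ∈ G \ B) (hi : i ∈ G \ B) (hj : j ∈ G \ B) (huv : u ≠ v) (hui : u ≠ i) (huj : u ≠ j)
    (hvi : v ≠ i) (hvj : v ≠ j) (hij : i ≠ j) (hmu : mTr M (insert u B) + 8 ≤ q)
    (hmv : mTr M (insert v B) + 8 ≤ q) : 2 / ((q : ℚ) + 1) ≤ rec M G q B := by
  have huB := (Finset.mem_sdiff.1 hu).2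
  have hvB := (Finset.mem_sdiff.1 hv).2
  have hiB := (Finset.mem_sdiff.1 hi).2
  have hjB := (Finset.mem_sdiff.1 hj).2
  set f : Finset α → ℚ := fun S => surplus M G q S / (bIn M G q S : ℚ) with hf
  have hf0 : ∀ S ∈ (SNq M G q).filter (fun S : Finset α => B ⊆ S), 0 ≤ f S := by
    intro S hS
    have hS' := (Finset.mem_filter.1 hS).1
    apply div_nonneg (surplus_nonneg hs hG hrG hS')
    positivity
  -- the singles
  set T1 : Finset (Finset α) := ({u, v, i, j} : Finset α).image (fun a => insert a B) with hT1
  have hT1sub : T1 ⊆ (SNq M G q).filter (fun S : Finset α => B ⊆ S) := by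
    intro S hS
    rw [hT1, Finset.mem_image] at hS
    obtain ⟨a, ha, rfl⟩ := hS
    simp only [Finset.mem_insert, Finset.mem_singleton] at ha
    have ha' : a ∈ G \ B := by
      rcases ha with rfl | rfl | rfl | rfl
      · exact hu
      · exact hv
      · exact hi
      · exact hj
    exact Finset.mem_filter.2 ⟨(insert_mem_SNq hrG hB ha').1, Finset.subset_insert a B⟩
  have hsum1 : ∑ S ∈ T1, f S = f (insert u B) + (f (insert v B) + (f (insert i B) + f (insert j B))) := by
    rw [hT1, Finset.sum_image]
    · rw [Finset.sum_insert, Finset.sum_insert, Finset.sum_pair hij]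
      · simp only [Finset.mem_insert, Finset.mem_singleton, not_or]
        exact ⟨hvi, hvj⟩
      · simp only [Finset.mem_insert, Finset.mem_singleton, not_or]
        exact ⟨huv, hui, huj⟩
    · intro a ha b hb hab
      have haB : a ∉ B := by
        simp only [Finset.coe_insert, Finset.coe_singleton, Set.mem_insert_iff, Set.mem_singleton_iff] at ha
        rcases ha with rfl | rfl | rfl | rfl
        · exact huB
        · exact hvB
        · exact hiB
        · exact hjB
      exact eq_of_insert_eq haB hab
  -- the pairs
  set T2 : Finset (Finset α) := (({i, j} : Finset α) ×ˢ ({u, v} : Finset α)).image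
    (fun p : α × α => insert p.1 (insert p.2 B)) with hT2
  have hT2sub : T2 ⊆ (SNq M G q).filter (fun S : Finset α => B ⊆ S) := by
    intro S hS
    rw [hT2, Finset.mem_image] at hS
    obtain ⟨p, hp, rfl⟩ := hS
    rw [Finset.mem_product] at hp
    simp only [Finset.mem_insert, Finset.mem_singleton] at hp
    have hp1 : p.1 ∈ G \ B := by rcases hp.1 with h | h <;> rw [h] <;> assumption
    have hp2 : p.2 ∈ G \ B := by rcases hp.2 with h | h <;> rw [h] <;> assumption
    have hne : p.1 ≠ p.2 := by
      rcases hp.1 with h1 | h1 <;> rcases hp.2 with h2 | h2 <;> rw [h1, h2]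
      · exact Ne.symm hui
      · exact Ne.symm hvi
      · exact Ne.symm huj
      · exact Ne.symm hvj
    exact Finset.mem_filter.2 ⟨(insert_insert_mem_SNq hrG hB hp1 hp2 hne).1,
      (Finset.subset_insert p.2 B).trans (Finset.subset_insert p.1 _)⟩
  have hsum2 : ∑ S ∈ T2, f S = (f (insert i (insert u B)) + f (insert i (insert v B))) +
      (f (insert j (insert u B)) + f (insert j (insert v B))) := by
    rw [hT2, Finset.sum_image]
    · rw [Finset.sum_product, Finset.sum_pair hij, Finset.sum_pair huv, Finset.sum_pair huv]
    · intro p hp p' hp' hpp'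
      simp only [Finset.coe_product, Finset.coe_insert, Finset.coe_singleton, Set.mem_prod, Set.mem_insert_iff,
        Set.mem_singleton_iff] at hp hp'
      have hp1B : p.1 ∉ B := by rcases hp.1 with h | h <;> rw [h] <;> assumption
      have hp2B : p.2 ∉ B := by rcases hp.2 with h | h <;> rw [h] <;> assumption
      have hp1B' : p'.1 ∉ B := by rcases hp'.1 with h | h <;> rw [h] <;> assumption
      have hp2B' : p'.2 ∉ B := by rcases hp'.2 with h | h <;> rw [h] <;> assumption
      have hpp'' : insert p.1 (insert p.2 B) = insert p'.1 (insert p'.2 B) := hpp'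
      have hsd : ({p.1, p.2} : Finset α) = {p'.1, p'.2} := by
        rw [← insert_insert_sdiff hp1B hp2B, ← insert_insert_sdiff hp1B' hp2B', hpp'']
      -- `p.1 ∈ {i, j}` cannot equal `p'.2 ∈ {u, v}`
      have hp1 : p.1 ∈ ({p'.1, p'.2} : Finset α) := by rw [← hsd]; simp
      have hp1ne : p.1 ≠ p'.2 := by
        rcases hp.1 with h1 | h1 <;> rcases hp'.2 with h2 | h2 <;> rw [h1, h2]
        · exact Ne.symm hui
        · exact Ne.symm hvi
        · exact Ne.symm huj
        · exact Ne.symm hvj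
      have h11 : p.1 = p'.1 := by
        simp only [Finset.mem_insert, Finset.mem_singleton] at hp1
        rcases hp1 with h | h
        · exact h
        · exact absurd h hp1ne
      have hp2 : p.2 ∈ ({p'.1, p'.2} : Finset α) := by rw [← hsd]; simp
      have hp2ne : p.2 ≠ p'.1 := by
        rcases hp.2 with h1 | h1 <;> rcases hp'.1 with h2 | h2 <;> rw [h1, h2]
        · exact hui
        · exact huj
        · exact hvi
        · exact hvj
      have h22 : p.2 = p'.2 := by
        simp only [Finset.mem_insert, Finset.mem_singleton] at hp2
        rcases hp2 with h | h
        · exact absurd h hp2ne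
        · exact h
      exact Prod.ext h11 h22
  -- `T1` and `T2` are disjoint (cards `q + 1` and `q + 2`)
  have hdisj : Disjoint T1 T2 := by
    rw [Finset.disjoint_left]
    intro S hS1 hS2
    rw [hT1, Finset.mem_image] at hS1
    rw [hT2, Finset.mem_image] at hS2
    obtain ⟨a, ha, rfl⟩ := hS1
    obtain ⟨p, hp, hpS⟩ := hS2
    rw [Finset.mem_product] at hp
    simp only [Finset.mem_insert, Finset.mem_singleton] at ha hp
    have haB : a ∉ B := by rcases ha with rfl | rfl | rfl | rfl <;> assumption
    have hp1B : p.1 ∉ B := by rcases hp.1 with h | h <;> rw [h] <;> assumption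
    have hp2B : p.2 ∉ B := by rcases hp.2 with h | h <;> rw [h] <;> assumption
    have hne : p.1 ≠ p.2 := by
      rcases hp.1 with h1 | h1 <;> rcases hp.2 with h2 | h2 <;> rw [h1, h2]
      · exact Ne.symm hui
      · exact Ne.symm hvi
      · exact Ne.symm huj
      · exact Ne.symm hvj
    have hp1B2 : p.1 ∉ insert p.2 B := by
      rw [Finset.mem_insert, not_or]
      exact ⟨hne, hp1B⟩
    have h1 := congrArg Finset.card hpS
    rw [Finset.card_insert_of_notMem hp1B2, Finset.card_insert_of_notMem hp2B, Finset.card_insert_of_notMem haB] at h1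
    omega
  have hrec : ∑ S ∈ T1 ∪ T2, f S ≤ rec M G q B := by
    unfold rec
    apply Finset.sum_le_sum_of_subset_of_nonneg (Finset.union_subset hT1sub hT2sub)
    intro S hS _
    exact hf0 S hS
  rw [Finset.sum_union hdisj, hsum1, hsum2] at hrec
  -- the long singles
  obtain ⟨hSu, hcu⟩ := insert_mem_SNq hrG hB hu
  obtain ⟨hSv, hcv⟩ := insert_mem_SNq hrG hB hv
  have hLu := surplus_div_bIn_ge_of_long hG (mem_SNq.1 hSu).1 (mem_SNq.1 hSu).2.1 hcu hmu
  have hLv := surplus_div_bIn_ge_of_long hG (mem_SNq.1 hSv).1 (mem_SNq.1 hSv).2.1 hcv hmv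
  -- the two small budgets
  have hBi := small_budget hs hG hrG hB hq hi hu hv (Ne.symm hui) (Ne.symm hvi) hmu hmv
  have hBj := small_budget hs hG hrG hB hq hj hu hv (Ne.symm huj) (Ne.symm hvj) hmu hmv
  have hq1 : (0 : ℚ) < (q : ℚ) + 1 := by positivity
  have hkey : 2 / ((q : ℚ) + 1) ≤ 2 * (2 / (3 * ((q : ℚ) + 1))) + 2 * ((4 / 9) / ((q : ℚ) + 1)) := by
    rw [div_le_iff₀ hq1]
    field_simp
    ring_nf
    nlinarith
  simp only [hf] at hrec
  linarith


end PercRepro.Star
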